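import Mathlib.Analysis.Complex.Basic
import Mathlib.Algebra.BigOperators.Fin
import Mathlib.Data.Fin.Tuple.Basic
import Literature.Computability.QuantumComplexity.SeparableCone
import Literature.Computability.QuantumComplexity.TreeProductFrames
import Literature.Computability.QuantumComplexity.TreeFramePairPotential
import HarnessLib

/-!
# Tensor powers of a two-qubit gadget: the symmetric separable body is ⊗-stable while the
# tree-frame value is multiplicative

Abstract engine behind the refutation of the crux `FrameDilationPolynomial` of route
`QuantumAdvantage/SeparableFrames` (theorem-only file, no new definitions).

Data: two two-qubit kernels `G` (a functional) and `A` (a direction), entries `K s t s' t' =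
⟨s t|K|s' t'⟩`, together with explicit product-vector decompositions of `1 + A` and `1 - A`
(so `1 ± A` lie in the fully separable cone of two qubits), and the potential data `(F, Q)` of
`IsTreeProductBasis.sum_norm_pairForm_le` for `G`.

* `exists_pairKernel_power`: for every `m` there is a fixed-point-free involution `σ` of the
  `2m` wires (nested pairs) such that the PAIR-PRODUCT operators
  `T_σ z z' = ∏_{j < σ j} A((z j, z σj), (z' j, z' σj))` (= `A^{⊗m}` up to wire order) and `M_σ`
  (same with `G`) satisfy `1 ± T_σ ∈ fullySeparableCone (2m)` — by
  `1 + A ⊗ T = ½[(1+A) ⊗ (1+T) + (1−A) ⊗ (1−T)]`, `1 − A ⊗ T = ½[(1+A) ⊗ (1−T) + (1−A) ⊗ (1+T)]`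
  and stability of the cone under tensoring with product projectors (`tensorHead`) — and
  `∑_{z z'} M_σ z z' T_σ z' z = (∑ G·A)^m` (`tr (G^{⊗m} A^{⊗m}) = tr(GA)^m`).
* `exists_separable_treeHeavy`: consequently, with `v = tr(G A)` real, the operator `T = T_σ` on
  `2m` qubits has `1 ± T` fully separable, yet EVERY real decomposition `T = ∑ₖ cₖ Dₖ` into
  tree-diagonal contractions (`treeDiagonalContractions (2m)`) has `v^m ≤ (Q²)^m ∑ₖ |cₖ|`
  (pair the decomposition with `M_σ`: `|tr(M_σ D)| ≤ Q^{2m}` for every tree contraction `D` by the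
  potential bound, while `tr(M_σ T) = v^m`).
For the X-state gadget of `SeparableFramesTwoQubitFrameExactnessRefutation` (`v = 43/8`,
`Q² = 5`) this gives tree-frame weight `≥ (43/40)^m` at separable radius `1` on `2m` qubits
(file `FrameDilationGadget`).  Elementary; context: Matthews–Wehner–Winter (arXiv:0810.2327)
bodies of restricted measurement classes.
-/

namespace Literature.Computability.QuantumComplexity

open Literature.Computability.Cryptography (QReg)
open scoped ComplexOrder

/-- Summing over `QReg (n + 1)` by first fixing wire `0` (`Fin.cons`). [folklore] -/
theorem sum_qreg_cons {M : Type*} [AddCommMonoid M] {n : ℕ} (F : QReg (n + 1) → M) :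
    ∑ z, F z = ∑ s : Bool, ∑ w : QReg n, F (Fin.cons s w) := by
  rw [sum_qreg_succ_split 0]
  simp only [Fin.insertNth_zero']

/-- Two labels on `n + 2` wires agree iff they agree on wires `0`, `1` and on the double tail.
[folklore] -/
theorem qreg_eq_iff_two {n : ℕ} (z z' : QReg (n + 2)) :
    z = z' ↔ z 0 = z' 0 ∧ z 1 = z' 1 ∧ Fin.tail (Fin.tail z) = Fin.tail (Fin.tail z') := by
  constructor
  · rintro rfl
    exact ⟨rfl, rfl, rfl⟩
  · rintro ⟨h0, h1, ht⟩
    funext i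
    refine Fin.cases h0 (fun i => ?_) i
    refine Fin.cases ?_ (fun k => ?_) i
    · simpa using h1
    · exact congrFun ht k

/-- The identity matrix on `n + 2` wires factors along wires `0`, `1` and the double tail.
[folklore] -/
theorem one_apply_qreg_two {n : ℕ} (z z' : QReg (n + 2)) :
    (1 : Matrix (QReg (n + 2)) (QReg (n + 2)) ℂ) z z' =
      (if z 0 = z' 0 then 1 else 0) * (if z 1 = z' 1 then 1 else 0) *
        (1 : Matrix (QReg n) (QReg n) ℂ) (Fin.tail (Fin.tail z)) (Fin.tail (Fin.tail z')) := by
  rw [Matrix.one_apply, Matrix.one_apply]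
  by_cases hz : z = z'
  · subst hz
    simp
  · have hne : ¬ (z 0 = z' 0 ∧ z 1 = z' 1 ∧ Fin.tail (Fin.tail z) = Fin.tail (Fin.tail z')) :=
      fun h => hz ((qreg_eq_iff_two z z').2 h)
    rw [if_neg hz]
    by_cases h0 : z 0 = z' 0 <;> by_cases h1 : z 1 = z' 1 <;>
      by_cases ht : Fin.tail (Fin.tail z) = Fin.tail (Fin.tail z') <;> simp_all

/-- **Tensoring a separable two-qubit head onto a member of the cone stays in the cone**:
`(∑ᵢ wᵢ |fᵢ ⊗ gᵢ⟩⟨fᵢ ⊗ gᵢ|) ⊗ Y ∈ fullySeparableCone (n + 2)` for `wᵢ ≥ 0` and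
`Y ∈ fullySeparableCone n` (head on wires `0`, `1`; two applications of `tensorHead`).
[folklore] -/
theorem tensorTwo_mem_fullySeparableCone {n K : ℕ} (w : Fin K → ℝ) (f g : Fin K → Bool → ℂ)
    (hw : ∀ i, 0 ≤ w i) {Y : Matrix (QReg n) (QReg n) ℂ} (hY : Y ∈ fullySeparableCone n) :
    (Matrix.of fun z z' : QReg (n + 2) =>
      (∑ i, (w i : ℂ) * (f i (z 0) * star (f i (z' 0))) * (g i (z 1) * star (g i (z' 1)))) *
        Y (Fin.tail (Fin.tail z)) (Fin.tail (Fin.tail z'))) ∈ fullySeparableCone (n + 2) := by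
  have key : (Matrix.of fun z z' : QReg (n + 2) =>
      (∑ i, (w i : ℂ) * (f i (z 0) * star (f i (z' 0))) * (g i (z 1) * star (g i (z' 1)))) *
        Y (Fin.tail (Fin.tail z)) (Fin.tail (Fin.tail z'))) =
      ∑ i, (w i : ℂ) • tensorHead (Matrix.vecMulVec (f i) (star (f i)))
        (tensorHead (Matrix.vecMulVec (g i) (star (g i))) Y) := by
    ext z z'
    simp only [Matrix.of_apply, Matrix.sum_apply, Matrix.smul_apply, smul_eq_mul,
      tensorHead_apply, Matrix.vecMulVec_apply, Pi.star_apply, Finset.sum_mul, Fin.tail,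
      Fin.succ_zero_eq_one]
    refine Finset.sum_congr rfl fun i _ => ?_
    ring
  rw [key]
  exact finsetSum_mem_fullySeparableCone _ fun i _ =>
    smul_mem_fullySeparableCone
      (tensorHead_mem_fullySeparableCone (Matrix.posSemidef_vecMulVec_self_star _)
        (tensorHead_mem_fullySeparableCone (Matrix.posSemidef_vecMulVec_self_star _) hY))
      (hw i)

/-- Peeling the head pair `{0, 1}` off a pair-product kernel: with the involution
`σ⁺ = (1, 0, σ + 2)` on `n + 2` wires,
`∏_{j < σ⁺ j} K(…) = K((z 0, z 1), (z' 0, z' 1)) · ∏_{k < σ k} K(…tails…)`. [folklore] -/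
theorem prod_pairKernel_succ_succ (K : Bool → Bool → Bool → Bool → ℂ) {n : ℕ} (σ : Fin n → Fin n)
    (σp : Fin (n + 2) → Fin (n + 2))
    (hσp : σp = Fin.cons 1 (Fin.cons 0 fun k => (σ k).succ.succ)) (z z' : QReg (n + 2)) :
    (∏ j, (if j < σp j then K (z j) (z (σp j)) (z' j) (z' (σp j)) else 1)) =
      K (z 0) (z 1) (z' 0) (z' 1) *
        ∏ k, (if k < σ k then
          K (z k.succ.succ) (z (σ k).succ.succ) (z' k.succ.succ) (z' (σ k).succ.succ) else 1) := by
  subst hσp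
  rw [Fin.prod_univ_succ, Fin.prod_univ_succ]
  have h01 : (0 : Fin (n + 2)) < 1 := Fin.zero_lt_one
  have h10 : ¬ (1 : Fin (n + 2)) < 0 := not_lt.2 (Fin.zero_le _)
  simp only [Fin.cons_zero, Fin.cons_succ, Fin.succ_zero_eq_one, Fin.cons_one,
    Fin.succ_lt_succ_iff, h01, h10, if_true, if_false, one_mul]

/-- Factoring a six-fold sum `∑ c(s,t,s',t') · d(w,w')` (head indices `s t`, `s' t'` around the
tail indices). [folklore] -/
theorem sum_six_mul_eq {κ : Type*} [Fintype κ] (c : Bool → Bool → Bool → Bool → ℂ)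
    (d : κ → κ → ℂ) :
    ∑ s, ∑ t, ∑ w, ∑ s', ∑ t', ∑ w', c s t s' t' * d w w' =
      (∑ s, ∑ t, ∑ s', ∑ t', c s t s' t') * ∑ w, ∑ w', d w w' := by
  calc ∑ s, ∑ t, ∑ w, ∑ s', ∑ t', ∑ w', c s t s' t' * d w w'
      = ∑ s, ∑ w, ∑ t, ∑ s', ∑ t', ∑ w', c s t s' t' * d w w' :=
        Finset.sum_congr rfl fun s _ => Finset.sum_comm
    _ = ∑ s, ∑ w, (∑ t, ∑ s', ∑ t', c s t s' t') * ∑ w', d w w' := by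
        refine Finset.sum_congr rfl fun s _ => Finset.sum_congr rfl fun w _ => ?_
        rw [Finset.sum_mul]
        refine Finset.sum_congr rfl fun t _ => ?_
        rw [Finset.sum_mul]
        refine Finset.sum_congr rfl fun s' _ => ?_
        rw [Finset.sum_mul]
        refine Finset.sum_congr rfl fun t' _ => ?_
        rw [Finset.mul_sum]
    _ = (∑ s, ∑ t, ∑ s', ∑ t', c s t s' t') * ∑ w, ∑ w', d w w' := by
        rw [Finset.sum_mul_sum]

/-- Trace recursion: pairing a head-times-tail kernel against another one,
`∑_{z z'} (G_head M_tail)(z,z') (A_head T_tail)(z',z) = (∑ G·A) · ∑_{w w'} M w w' T w' w`.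
[folklore] -/
theorem sum_headTail_mul_headTail (G A : Bool → Bool → Bool → Bool → ℂ) {n : ℕ}
    (M T : Matrix (QReg n) (QReg n) ℂ) :
    ∑ z : QReg (n + 2), ∑ z' : QReg (n + 2),
        (G (z 0) (z 1) (z' 0) (z' 1) * M (Fin.tail (Fin.tail z)) (Fin.tail (Fin.tail z'))) *
          (A (z' 0) (z' 1) (z 0) (z 1) * T (Fin.tail (Fin.tail z')) (Fin.tail (Fin.tail z))) =
      (∑ s, ∑ t, ∑ s', ∑ t', G s t s' t' * A s' t' s t) * ∑ w, ∑ w', M w w' * T w' w := by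
  simp only [sum_qreg_cons, Fin.cons_zero, Fin.cons_one, Fin.tail_cons]
  have h : ∀ (s t s' t' : Bool) (w w' : QReg n),
      G s t s' t' * M w w' * (A s' t' s t * T w' w) = (G s t s' t' * A s' t' s t) * (M w w' * T w' w) :=
    fun _ _ _ _ _ _ => by ring
  simp only [h]
  exact sum_six_mul_eq _ _

/-- **The pair-product family.** Given product-vector decompositions of `1 + A` and `1 - A`
(two-qubit kernels), for `n = 2m` there is a fixed-point-free involution `σ` of `Fin n` such that
the pair-product direction `T_σ = "A^{⊗m}"` has `1 ± T_σ` fully separable and pairs against the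
pair-product functional `M_σ = "G^{⊗m}"` to `(∑ G·A)^m`:
`𝒜 = {T : 1 ± T separable}` is closed under `⊗` (`1 + A⊗T = ½[(1+A)⊗(1+T) + (1−A)⊗(1−T)]`,
`1 − A⊗T = ½[(1+A)⊗(1−T) + (1−A)⊗(1+T)]`) and traces multiply. [folklore] -/
theorem exists_pairKernel_power (G A : Bool → Bool → Bool → Bool → ℂ)
    (hplus : ∃ (K : ℕ) (w : Fin K → ℝ) (f g : Fin K → Bool → ℂ), (∀ i, 0 ≤ w i) ∧
      ∀ s t s' t', (if s = s' then (1 : ℂ) else 0) * (if t = t' then 1 else 0) + A s t s' t' =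
        ∑ i, (w i : ℂ) * (f i s * star (f i s')) * (g i t * star (g i t')))
    (hminus : ∃ (K : ℕ) (w : Fin K → ℝ) (f g : Fin K → Bool → ℂ), (∀ i, 0 ≤ w i) ∧
      ∀ s t s' t', (if s = s' then (1 : ℂ) else 0) * (if t = t' then 1 else 0) - A s t s' t' =
        ∑ i, (w i : ℂ) * (f i s * star (f i s')) * (g i t * star (g i t')))
    (m n : ℕ) (hn : n = 2 * m) :
    ∃ σ : Fin n → Fin n, (∀ j, σ j ≠ j ∧ σ (σ j) = j) ∧
      (1 + Matrix.of (fun z z' : QReg n =>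
          ∏ j, (if j < σ j then A (z j) (z (σ j)) (z' j) (z' (σ j)) else 1)) ∈
        fullySeparableCone n) ∧
      (1 - Matrix.of (fun z z' : QReg n =>
          ∏ j, (if j < σ j then A (z j) (z (σ j)) (z' j) (z' (σ j)) else 1)) ∈
        fullySeparableCone n) ∧
      (∑ z : QReg n, ∑ z' : QReg n,
          (∏ j, (if j < σ j then G (z j) (z (σ j)) (z' j) (z' (σ j)) else 1)) *
            (∏ j, (if j < σ j then A (z' j) (z' (σ j)) (z j) (z (σ j)) else 1)) =
        (∑ s, ∑ t, ∑ s', ∑ t', G s t s' t' * A s' t' s t) ^ m) := by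
  induction m generalizing n with
  | zero =>
    obtain rfl : n = 0 := by omega
    refine ⟨fun j => j, fun j => j.elim0, ?_, ?_, ?_⟩
    · have h1 : (1 + Matrix.of (fun z z' : QReg 0 =>
          ∏ j : Fin 0, (if j < j then A (z j) (z j) (z' j) (z' j) else 1))) =
          ((2 : ℝ) : ℂ) • (1 : Matrix (QReg 0) (QReg 0) ℂ) := by
        ext z z'
        have hz : z = z' := Subsingleton.elim _ _
        subst hz
        rw [Matrix.add_apply, Matrix.one_apply_eq, Matrix.of_apply, Matrix.smul_apply,
          Matrix.one_apply_eq, Finset.univ_eq_empty, Finset.prod_empty, smul_eq_mul, mul_one]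
        norm_num
      rw [h1]
      exact smul_one_mem_fullySeparableCone (by norm_num)
    · have h1 : (1 - Matrix.of (fun z z' : QReg 0 =>
          ∏ j : Fin 0, (if j < j then A (z j) (z j) (z' j) (z' j) else 1))) = 0 := by
        ext z z'
        have hz : z = z' := Subsingleton.elim _ _
        subst hz
        rw [Matrix.sub_apply, Matrix.one_apply_eq, Matrix.of_apply, Matrix.zero_apply,
          Finset.univ_eq_empty, Finset.prod_empty, sub_self]
      rw [h1]
      exact zero_mem_fullySeparableCone
    · simp
  | succ m ih =>
    obtain ⟨k, rfl⟩ : ∃ k, n = k + 2 := ⟨2 * m, by omega⟩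
    obtain ⟨σ, hσ, hp, hm, htr⟩ := ih k (by omega)
    obtain ⟨K₁, w₁, f₁, g₁, hw₁, hA₁⟩ := hplus
    obtain ⟨K₂, w₂, f₂, g₂, hw₂, hA₂⟩ := hminus
    set T : Matrix (QReg k) (QReg k) ℂ := Matrix.of (fun w w' : QReg k =>
      ∏ j, (if j < σ j then A (w j) (w (σ j)) (w' j) (w' (σ j)) else 1)) with hT
    set σp : Fin (k + 2) → Fin (k + 2) := Fin.cons 1 (Fin.cons 0 fun j => (σ j).succ.succ)
      with hσp
    have hrecA : ∀ z z' : QReg (k + 2),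
        (∏ j, (if j < σp j then A (z j) (z (σp j)) (z' j) (z' (σp j)) else 1)) =
          A (z 0) (z 1) (z' 0) (z' 1) * T (Fin.tail (Fin.tail z)) (Fin.tail (Fin.tail z')) :=
      fun z z' => by rw [prod_pairKernel_succ_succ A σ σp hσp]; rfl
    have hrecA' : ∀ z z' : QReg (k + 2),
        (∏ j, (if j < σp j then A (z' j) (z' (σp j)) (z j) (z (σp j)) else 1)) =
          A (z' 0) (z' 1) (z 0) (z 1) * T (Fin.tail (Fin.tail z')) (Fin.tail (Fin.tail z)) :=
      fun z z' => hrecA z' z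
    have hrecG : ∀ z z' : QReg (k + 2),
        (∏ j, (if j < σp j then G (z j) (z (σp j)) (z' j) (z' (σp j)) else 1)) =
          G (z 0) (z 1) (z' 0) (z' 1) * (Matrix.of fun w w' : QReg k =>
            ∏ j, (if j < σ j then G (w j) (w (σ j)) (w' j) (w' (σ j)) else 1))
              (Fin.tail (Fin.tail z)) (Fin.tail (Fin.tail z')) :=
      fun z z' => by rw [prod_pairKernel_succ_succ G σ σp hσp]; rfl
    refine ⟨σp, ?_, ?_, ?_, ?_⟩
    · -- `σp` is a fixed-point-free involution
      intro j
      refine Fin.cases ?_ (fun j => ?_) j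
      · simp [hσp]
      · refine Fin.cases ?_ (fun l => ?_) j
        · simp [hσp]
        · simp only [hσp, Fin.cons_succ]
          exact ⟨fun h => (hσ l).1 (Fin.succ_injective _ (Fin.succ_injective _ h)),
            by rw [(hσ l).2]⟩
    · -- `1 + T⁺ = ½ [(1 + A) ⊗ (1 + T) + (1 - A) ⊗ (1 - T)]`
      have heq : (1 + Matrix.of (fun z z' : QReg (k + 2) =>
            ∏ j, (if j < σp j then A (z j) (z (σp j)) (z' j) (z' (σp j)) else 1))) =
          ((1 / 2 : ℝ) : ℂ) • ((Matrix.of fun z z' : QReg (k + 2) =>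
              (∑ i, (w₁ i : ℂ) * (f₁ i (z 0) * star (f₁ i (z' 0))) *
                (g₁ i (z 1) * star (g₁ i (z' 1)))) *
                (1 + T) (Fin.tail (Fin.tail z)) (Fin.tail (Fin.tail z'))) +
            (Matrix.of fun z z' : QReg (k + 2) =>
              (∑ i, (w₂ i : ℂ) * (f₂ i (z 0) * star (f₂ i (z' 0))) *
                (g₂ i (z 1) * star (g₂ i (z' 1)))) *
                (1 - T) (Fin.tail (Fin.tail z)) (Fin.tail (Fin.tail z')))) := by
        ext z z'
        simp only [Matrix.add_apply, Matrix.sub_apply, Matrix.of_apply, Matrix.smul_apply,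
          smul_eq_mul, hrecA, ← hA₁, ← hA₂, one_apply_qreg_two]
        push_cast
        ring
      rw [heq]
      exact smul_mem_fullySeparableCone (add_mem_fullySeparableCone
        (tensorTwo_mem_fullySeparableCone w₁ f₁ g₁ hw₁ hp)
        (tensorTwo_mem_fullySeparableCone w₂ f₂ g₂ hw₂ hm)) (by norm_num)
    · -- `1 - T⁺ = ½ [(1 + A) ⊗ (1 - T) + (1 - A) ⊗ (1 + T)]`
      have heq : (1 - Matrix.of (fun z z' : QReg (k + 2) =>
            ∏ j, (if j < σp j then A (z j) (z (σp j)) (z' j) (z' (σp j)) else 1))) =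
          ((1 / 2 : ℝ) : ℂ) • ((Matrix.of fun z z' : QReg (k + 2) =>
              (∑ i, (w₁ i : ℂ) * (f₁ i (z 0) * star (f₁ i (z' 0))) *
                (g₁ i (z 1) * star (g₁ i (z' 1)))) *
                (1 - T) (Fin.tail (Fin.tail z)) (Fin.tail (Fin.tail z'))) +
            (Matrix.of fun z z' : QReg (k + 2) =>
              (∑ i, (w₂ i : ℂ) * (f₂ i (z 0) * star (f₂ i (z' 0))) *
                (g₂ i (z 1) * star (g₂ i (z' 1)))) *
                (1 + T) (Fin.tail (Fin.tail z)) (Fin.tail (Fin.tail z')))) := by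
        ext z z'
        simp only [Matrix.add_apply, Matrix.sub_apply, Matrix.of_apply, Matrix.smul_apply,
          smul_eq_mul, hrecA, ← hA₁, ← hA₂, one_apply_qreg_two]
        push_cast
        ring
      rw [heq]
      exact smul_mem_fullySeparableCone (add_mem_fullySeparableCone
        (tensorTwo_mem_fullySeparableCone w₁ f₁ g₁ hw₁ hm)
        (tensorTwo_mem_fullySeparableCone w₂ f₂ g₂ hw₂ hp)) (by norm_num)
    · -- traces multiply
      simp only [hrecG, hrecA']
      rw [sum_headTail_mul_headTail, pow_succ, mul_comm]
      congr 1

/-- **Separable directions with exponentially heavy tree frames (abstract form).**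
Let `G`, `A` be two-qubit kernels with `1 ± A` explicitly separable, `(F, Q)` potential data for
`G` as in `IsTreeProductBasis.sum_norm_pairForm_le`, and `tr(G A) = v` real. Then for every `m`
there is an operator `T` on `2m` qubits (`T = A^{⊗m}` on nested wire pairs) with `1 + T` and
`1 - T` in `fullySeparableCone (2m)` such that every real decomposition `T = ∑ₖ cₖ Dₖ` into
LOCC-tree diagonal contractions `Dₖ ∈ treeDiagonalContractions (2m)` has
`v ^ m ≤ (Q·Q) ^ m · ∑ₖ |cₖ|`.  (The tree-frame value of `G^{⊗m}` is `≤ Q^{2m}` — adaptive trees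
gain nothing on tensor powers — while `tr(G^{⊗m} T) = v^m`.) [folklore] -/
theorem exists_separable_treeHeavy (G A : Bool → Bool → Bool → Bool → ℂ)
    (hG : ∀ s t s' t', G s t s' t' = G t s t' s') (F : (Bool → ℂ) → ℝ) (Q v : ℝ) (hQ : 0 ≤ Q)
    (hFQ : ∀ u : Bool → Bool → ℂ, IsQubitONB u → ∑ b, F (u b) ≤ Q * Q)
    (hGF : ∀ (α : Bool → ℂ) (u : Bool → Bool → ℂ), ∑ t, star (α t) * α t = 1 → IsQubitONB u →
      ∑ b, ‖∑ t, ∑ t', star (u b t) * (∑ s, ∑ s', star (α s) * G s t s' t' * α s') * u b t'‖ ≤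
        F α)
    (hplus : ∃ (K : ℕ) (w : Fin K → ℝ) (f g : Fin K → Bool → ℂ), (∀ i, 0 ≤ w i) ∧
      ∀ s t s' t', (if s = s' then (1 : ℂ) else 0) * (if t = t' then 1 else 0) + A s t s' t' =
        ∑ i, (w i : ℂ) * (f i s * star (f i s')) * (g i t * star (g i t')))
    (hminus : ∃ (K : ℕ) (w : Fin K → ℝ) (f g : Fin K → Bool → ℂ), (∀ i, 0 ≤ w i) ∧
      ∀ s t s' t', (if s = s' then (1 : ℂ) else 0) * (if t = t' then 1 else 0) - A s t s' t' =
        ∑ i, (w i : ℂ) * (f i s * star (f i s')) * (g i t * star (g i t')))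
    (hv : ∑ s, ∑ t, ∑ s', ∑ t', G s t s' t' * A s' t' s t = (v : ℂ)) (m : ℕ) :
    ∃ T : Matrix (QReg (2 * m)) (QReg (2 * m)) ℂ,
      1 + T ∈ fullySeparableCone (2 * m) ∧ 1 - T ∈ fullySeparableCone (2 * m) ∧
      ∀ (K : ℕ) (c : Fin K → ℝ) (D : Fin K → Matrix (QReg (2 * m)) (QReg (2 * m)) ℂ),
        (∀ k, D k ∈ treeDiagonalContractions (2 * m)) → T = ∑ k, ((c k : ℂ)) • D k →
        v ^ m ≤ (Q * Q) ^ m * ∑ k, |c k| := by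
  obtain ⟨σ, hσ, hp, hm, htr⟩ := exists_pairKernel_power G A hplus hminus m (2 * m) rfl
  refine ⟨_, hp, hm, fun K c D hD hT => ?_⟩
  set M : QReg (2 * m) → QReg (2 * m) → ℂ := fun z z' =>
    ∏ j, (if j < σ j then G (z j) (z (σ j)) (z' j) (z' (σ j)) else 1) with hM
  -- (1) every tree contraction pairs against `M` with modulus at most `Q ^ (2m)`
  have hDk : ∀ k, ‖∑ z, ∑ z', M z z' * D k z' z‖ ≤ (Q * Q) ^ m := by
    intro k
    obtain ⟨e, ε, he, hε, hDe⟩ := hD k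
    have hL1 := IsTreeProductBasis.sum_norm_pairForm_le G hG F Q hQ hFQ hGF (2 * m) e he σ
      (fun _ => false) (fun _ _ => 0) (fun j _ => ⟨(hσ j).1, (hσ j).2, rfl⟩)
      (fun j hj => absurd hj (by simp))
    simp only [Bool.false_eq_true, if_false, Finset.prod_const, Finset.card_univ,
      Fintype.card_fin] at hL1
    -- hL1 : ∑ y, ‖∑ z, ∑ z', star (e y z) * M z z' * e y z'‖ ≤ Q ^ (2 * m)
    have hexp : ∑ z, ∑ z', M z z' * D k z' z =
        ∑ y, (ε y : ℂ) * ∑ z, ∑ z', star (e y z) * M z z' * e y z' := by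
      rw [hDe]
      simp only [frameDiagonal, Matrix.sum_apply, Matrix.smul_apply, Matrix.vecMulVec_apply,
        Pi.star_apply, smul_eq_mul, Finset.mul_sum]
      calc ∑ z, ∑ z', ∑ y, M z z' * ((ε y : ℂ) * (e y z' * star (e y z)))
          = ∑ z, ∑ y, ∑ z', M z z' * ((ε y : ℂ) * (e y z' * star (e y z))) :=
            Finset.sum_congr rfl fun z _ => Finset.sum_comm
        _ = ∑ y, ∑ z, ∑ z', M z z' * ((ε y : ℂ) * (e y z' * star (e y z))) := Finset.sum_comm
        _ = ∑ y, ∑ z, ∑ z', (ε y : ℂ) * (star (e y z) * M z z' * e y z') := by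
            refine Finset.sum_congr rfl fun y _ => Finset.sum_congr rfl fun z _ =>
              Finset.sum_congr rfl fun z' _ => ?_
            ring
    rw [hexp]
    calc ‖∑ y, (ε y : ℂ) * ∑ z, ∑ z', star (e y z) * M z z' * e y z'‖
        ≤ ∑ y, ‖(ε y : ℂ) * ∑ z, ∑ z', star (e y z) * M z z' * e y z'‖ := norm_sum_le _ _
      _ ≤ ∑ y, ‖∑ z, ∑ z', star (e y z) * M z z' * e y z'‖ := by
          refine Finset.sum_le_sum fun y _ => ?_
          rw [norm_mul, Complex.norm_real, Real.norm_eq_abs]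
          exact mul_le_of_le_one_left (norm_nonneg _) (hε y)
      _ ≤ Q ^ (2 * m) := hL1
      _ = (Q * Q) ^ m := by rw [pow_mul, sq]
  -- (2) pairing `M` against `T` gives `v ^ m`
  have hMT : ∑ z, ∑ z', M z z' * (∑ k, ((c k : ℂ)) • D k) z' z = (v : ℂ) ^ m := by
    rw [← hT, ← hv, ← htr]
    simp only [hM, Matrix.of_apply]
  have hlin : ∑ z, ∑ z', M z z' * (∑ k, ((c k : ℂ)) • D k) z' z =
      ∑ k, (c k : ℂ) * ∑ z, ∑ z', M z z' * D k z' z := by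
    simp only [Matrix.sum_apply, Matrix.smul_apply, smul_eq_mul, Finset.mul_sum]
    calc ∑ z, ∑ z', ∑ k, M z z' * ((c k : ℂ) * D k z' z)
        = ∑ z, ∑ k, ∑ z', M z z' * ((c k : ℂ) * D k z' z) :=
          Finset.sum_congr rfl fun z _ => Finset.sum_comm
      _ = ∑ k, ∑ z, ∑ z', M z z' * ((c k : ℂ) * D k z' z) := Finset.sum_comm
      _ = ∑ k, ∑ z, ∑ z', (c k : ℂ) * (M z z' * D k z' z) := by
          refine Finset.sum_congr rfl fun k _ => Finset.sum_congr rfl fun z _ =>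
            Finset.sum_congr rfl fun z' _ => ?_
          ring
  -- (3) compare
  have hnorm : ‖(v : ℂ) ^ m‖ ≤ (Q * Q) ^ m * ∑ k, |c k| := by
    rw [← hMT, hlin]
    calc ‖∑ k, (c k : ℂ) * ∑ z, ∑ z', M z z' * D k z' z‖
        ≤ ∑ k, ‖(c k : ℂ) * ∑ z, ∑ z', M z z' * D k z' z‖ := norm_sum_le _ _
      _ ≤ ∑ k, |c k| * (Q * Q) ^ m := by
          refine Finset.sum_le_sum fun k _ => ?_
          rw [norm_mul, Complex.norm_real, Real.norm_eq_abs]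
          exact mul_le_mul_of_nonneg_left (hDk k) (abs_nonneg _)
      _ = (Q * Q) ^ m * ∑ k, |c k| := by rw [← Finset.sum_mul, mul_comm]
  calc v ^ m ≤ |v ^ m| := le_abs_self _
    _ = ‖(v : ℂ) ^ m‖ := by rw [← Complex.ofReal_pow, Complex.norm_real, Real.norm_eq_abs]
    _ ≤ (Q * Q) ^ m * ∑ k, |c k| := hnorm

end Literature.Computability.QuantumComplexity
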